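import Literature.MathematicalPhysics.QuantumChemistry.DualConeLowerBound
import Literature.MathematicalPhysics.QuantumChemistry.GCondition
import Literature.MathematicalPhysics.QuantumChemistry.T1Condition
import HarnessLib

/-!
# Necessary `N`-representability conditions: the NAMED conditions of the topic as instances of the
# arbitrary-condition-set lower bound (Cancès–Stoltz–Lewin 2006 §3; Nakata et al. 2008 §II.C)

Topic `Literature/MathematicalPhysics/QuantumChemistry`; companion of `DualConeLowerBound.lean`, which
types the RDM lower bound for an ARBITRARY finite set of necessary conditions
(`IsNecessary N C` / `IsNecessaryInSector a b C`, `le_groundEnergy_of_forall_necessary`,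
`le_sectorGroundEnergy_of_forall_necessary`, the dual-cone certificate) and records as instances the
`Q` condition and the topic's two fixed lists `PQG` and `PQGT1T2′`.  Since then the topic has named,
one file per printed condition, the stand-alone predicates `GCondition` (`GCondition.lean`),
`T2Condition` / `T2PrimeCondition` and the `PQGT1T2` lists `IsDQGT1T2Feasible(Sector)`
(`T2Condition.lean`), `T1Condition` (`T1Condition.lean`) and the `PQGT1` lists
`IsDQGT1Feasible(Sector)` (`ErdahlT1Condition.lean`), each with its own necessity lemma for states
(`gCondition_rdm`, `t1Condition_rdm`, `t2Condition_rdm`, `t2PrimeCondition_rdm`, `….of_state`).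
This file plugs every one of them into the aggregator — so that a lower row computed with ANY of the
printed rungs

  `E_PQG ≤ E_PQGT1 ≤ E_PQGT1T2 ≤ E_PQGT1T2′ ≤ E_fullCI`   (Nakata et al. 2008 §II.C, held copy
  `paper:doi-10-1063-1-2911696` p. 164113-4 opened 2026-08-26: "there are obvious inclusion relations
  between the 2-RDMs satisfying PQG, PQGT1, PQGT1T2, and PQGT1T2′. Hence, the energies obtained by the
  RDM method with these conditions satisfy …"),

or with any conjunction / finite family / principal-submatrix restriction of the named conditions, cites
ONE necessity declaration and the generic bound.  Source of the generic statement: E. Cancès, G. Stoltz,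
M. Lewin, J. Chem. Phys. 125 (2006) 064101 §3 (held copy `paper:arxiv-quant-ph_0602042` p. 5 opened
2026-08-26): "some necessary conditions for `N`-representability are selected. We consider in this paper
`L` conditions of the following general form `∀ ℓ = 1…L, 𝓛_ℓ(Γ) ≥ 0` (7) … Some well-known necessary
conditions of the form (7) are the P, Q, G conditions. Additional necessary conditions can be
considered, such as Erdahl's T₁ and T₂ conditions … our algorithm … is valid for any set of necessary
conditions of the form (7)."

CONTENTS (everything PROVED, 0 sorry, no definition, no named fact; each proof is a one-line
instantiation of the cited topic lemma):

1. `N`-electron instances `isNecessary_dCondition` (`Γ ⪰ 0`), `isNecessary_gCondition`,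
   `isNecessary_t1Condition`, `isNecessary_t2Condition`, `isNecessary_t2PrimeCondition`,
   `isNecessary_isDQGT1Feasible`, `isNecessary_isDQGT1T2Feasible`; sector instances
   `isNecessaryInSector_qCondition`, `…_dCondition`, `…_gCondition`, `…_t1Condition`,
   `…_t2Condition`, `…_t2PrimeCondition`, `…_isDQGT1FeasibleSector`, `…_isDQGT1T2FeasibleSector`
   (the last two are the necessity declarations a `DQGT1` / `DQGT1T2` lower row cites; the chain
   `PQGT1T2′ ⊆ PQGT1T2 ⊆ PQGT1 ⊆ PQG` itself is `T1Condition.lean` / `T2Condition.lean`).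
2. Closure of necessity under the operations a condition LIST is built with: finite conjunction over an
   index type (`isNecessary_forall`, `isNecessaryInSector_forall` — CSL's `∀ ℓ = 1…L`), finite families of
   matrix-positivity maps (`isNecessary_posMapFeasible`, `isNecessaryInSector_posMapFeasible` — CSL
   eq. (7) from the necessity of each `𝓛_ℓ(Γ) ≥ 0`), and RESTRICTION TO A PRINCIPAL SUBMATRIX
   (`IsNecessary.posSemidef_submatrix`, `IsNecessaryInSector.posSemidef_submatrix`: if `M(γ, Γ) ⪰ 0` is
   necessary then so is `M(γ, Γ)[e, e] ⪰ 0` for every re-indexing `e` — a principal submatrix of a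
   positive semidefinite matrix is positive semidefinite, Horn–Johnson Observation 7.1.2; the soundness of
   block-selected "restricted" `T1`/`T2`/`T2′` conditions, `RestrictedThreeIndexConditions.lean`, in the
   language of condition sets), with the instances `isNecessary_t1Map_submatrix`,
   `isNecessary_t2Map_submatrix`, `isNecessary_t2PrimeMap_submatrix` and their sector forms.

NOT HERE: any bound on a particular molecule; the values `E_PQGT1`, `E_PQGT1T2` as real numbers (the
junk-free "every `c` below the functional on the feasible set" form of `DualConeLowerBound.lean` is kept);
spin-adapted / symmetry-reduced condition sets (venture side, `Rows/SpinFlipQuotient.lean`).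

## References
* E. Cancès, G. Stoltz, M. Lewin, J. Chem. Phys. 125 (2006) 064101 = arXiv:quant-ph/0602042, §3
  eq. (7) and the paragraph after eq. (10). [cite: CancesStoltzLewin2006, §3 eq. (7)]
* M. Nakata, B. J. Braams, K. Fujisawa, M. Fukuda, J. K. Percus, M. Yamashita, Z. Zhao, J. Chem. Phys.
  128 (2008) 164113, §II.A (the conditions), §II.C (the chain). [cite: NakataEtAl2008, §II.A-C]
* R. A. Horn, C. R. Johnson, *Matrix Analysis*, 2nd ed. (2013), Observation 7.1.2 (principal
  submatrices of positive semidefinite matrices). [cite: HornJohnson2013, Obs. 7.1.2]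
* D. A. Mazziotti, Adv. Chem. Phys. 134 (2007) ch. 3 §II.B (D, Q, G), §II.F (`S_z` sectors).
  [cite: Mazziotti2007RDMChapter, §II.B, §II.F]
-/

namespace Literature.MathematicalPhysics.QuantumChemistry

open Matrix Literature.MathematicalPhysics.QuantumLattice
open scoped ComplexOrder

/-! ### 1. `N`-electron instances: each named condition of the topic is necessary -/

section NElectron

variable {ι : Type*} [LinearOrder ι] [Fintype ι]

/-- Instance: the **D (= P) condition** `Γ ⪰ 0` — CSL's `𝓛₁(Γ) = Γ ≥ 0`, which "originates from the
Kummer operator preserving positivity, and will always be considered" — written as the predicate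
`fun _ Γ => Γ.PosSemidef` (in the topic it is the field `IsDQGFeasible.d_psd`; on states
`twoRDM_posSemidef`), is necessary for every `N`. [cite: CancesStoltzLewin2006, §3 eq. (7)] -/
theorem isNecessary_dCondition (N : ℕ) :
    IsNecessary N (fun (_ : Matrix ι ι ℂ) (Γ : Matrix (ι × ι) (ι × ι) ℂ) => Γ.PosSemidef) :=
  fun ψ _ _ => twoRDM_posSemidef ψ

/-- Instance: the stand-alone **G condition** `GCondition γ Γ` (`gMap γ Γ ⪰ 0`, `GCondition.lean`;
Mazziotti 2007 eqs. (13), (15)) is necessary for every `N` (`gCondition_rdm`: every Fock vector).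
CSL §3: "Some well-known necessary conditions of the form (7) are the P, Q, G conditions".
[cite: CancesStoltzLewin2006, §3 eq. (7)] -/
theorem isNecessary_gCondition (N : ℕ) : IsNecessary N (GCondition (ι := ι)) :=
  fun ψ _ _ => gCondition_rdm ψ

/-- Instance: the stand-alone **T1 condition** `T1Condition γ Γ` (`t1Map γ Γ ⪰ 0`, Erdahl 1978 /
Braams–Percus–Zhao 2007 eq. (3); `T1Condition.lean`, on unit states `t1Condition_rdm`) is necessary for
every `N`. CSL §3:
"Additional necessary conditions can be considered, such as Erdahl's T₁ and T₂ conditions".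
[cite: CancesStoltzLewin2006, §3 eq. (7)] -/
theorem isNecessary_t1Condition (N : ℕ) : IsNecessary N (T1Condition (ι := ι)) :=
  fun _ _ h1 => t1Condition_rdm h1

/-- Instance: the stand-alone **T2 condition** `T2Condition γ Γ` (`t2Map γ Γ ⪰ 0`, Braams–Percus–Zhao
2007 eq. (5); `T2Condition.lean`, on states `t2Condition_rdm` — every Fock vector, no particle-number or
normalisation hypothesis) is necessary for every `N`. [cite: CancesStoltzLewin2006, §3 eq. (7)] -/
theorem isNecessary_t2Condition (N : ℕ) : IsNecessary N (T2Condition (ι := ι)) :=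
  fun ψ _ _ => t2Condition_rdm ψ

/-- Instance: the stand-alone **T2′ condition** `T2PrimeCondition γ Γ` (`t2PrimeMap γ Γ ⪰ 0`,
Braams–Percus–Zhao 2007 eqs. (4)–(6), Nakata et al. 2008 §II.B; `T2Condition.lean`, on states
`t2PrimeCondition_rdm`) is necessary for every `N`. [cite: NakataEtAl2008, §II.A-C] -/
theorem isNecessary_t2PrimeCondition (N : ℕ) : IsNecessary N (T2PrimeCondition (ι := ι)) :=
  fun ψ _ _ => t2PrimeCondition_rdm ψ

/-- Instance: the **PQGT1 list** `IsDQGT1Feasible N` (`ErdahlT1Condition.lean`) is necessary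
(`IsDQGT1Feasible.of_state`). "PQGT1 means P, Q, G, and T1 conditions." [cite: NakataEtAl2008, §II.A-C] -/
theorem isNecessary_isDQGT1Feasible (N : ℕ) : IsNecessary N (IsDQGT1Feasible (ι := ι) N) :=
  fun _ hN h1 => IsDQGT1Feasible.of_state hN h1

/-- Instance: the **PQGT1T2 list** `IsDQGT1T2Feasible N` (`T2Condition.lean`) is necessary
(`IsDQGT1T2Feasible.of_state`). Nakata et al. (2008) §II.C, third rung. [cite: NakataEtAl2008, §II.A-C] -/
theorem isNecessary_isDQGT1T2Feasible (N : ℕ) : IsNecessary N (IsDQGT1T2Feasible (ι := ι) N) :=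
  fun _ hN h1 => IsDQGT1T2Feasible.of_state hN h1

end NElectron

/-! ### 1′. Sector instances `(N_α, N_β) = (a, b)` -/

section Sector

variable {Λ : Type*} [LinearOrder Λ] [Fintype Λ]

/-- Sector instance: the **Q condition** is necessary in every sector `(a, b)` (from
`isNecessary_qCondition (a + b)`). [cite: CancesStoltzLewin2006, §3 eq. (7)] -/
theorem isNecessaryInSector_qCondition (a b : ℕ) :
    IsNecessaryInSector a b (QCondition (ι := Orb Λ)) :=
  (isNecessary_qCondition (a + b)).isNecessaryInSector

/-- Sector instance: the **D condition** `Γ ⪰ 0` is necessary in every sector `(a, b)`.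
[cite: CancesStoltzLewin2006, §3 eq. (7)] -/
theorem isNecessaryInSector_dCondition (a b : ℕ) :
    IsNecessaryInSector a b
      (fun (_ : Matrix (Orb Λ) (Orb Λ) ℂ) (Γ : Matrix (Orb Λ × Orb Λ) (Orb Λ × Orb Λ) ℂ) =>
        Γ.PosSemidef) :=
  (isNecessary_dCondition (a + b)).isNecessaryInSector

/-- Sector instance: the **G condition** is necessary in every sector `(a, b)`.
[cite: CancesStoltzLewin2006, §3 eq. (7)] -/
theorem isNecessaryInSector_gCondition (a b : ℕ) :
    IsNecessaryInSector a b (GCondition (ι := Orb Λ)) :=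
  (isNecessary_gCondition (a + b)).isNecessaryInSector

/-- Sector instance: the **T1 condition** is necessary in every sector `(a, b)`.
[cite: CancesStoltzLewin2006, §3 eq. (7)] -/
theorem isNecessaryInSector_t1Condition (a b : ℕ) :
    IsNecessaryInSector a b (T1Condition (ι := Orb Λ)) :=
  (isNecessary_t1Condition (a + b)).isNecessaryInSector

/-- Sector instance: the **T2 condition** is necessary in every sector `(a, b)`.
[cite: CancesStoltzLewin2006, §3 eq. (7)] -/
theorem isNecessaryInSector_t2Condition (a b : ℕ) :
    IsNecessaryInSector a b (T2Condition (ι := Orb Λ)) :=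
  (isNecessary_t2Condition (a + b)).isNecessaryInSector

/-- Sector instance: the **T2′ condition** is necessary in every sector `(a, b)`.
[cite: NakataEtAl2008, §II.A-C] -/
theorem isNecessaryInSector_t2PrimeCondition (a b : ℕ) :
    IsNecessaryInSector a b (T2PrimeCondition (ι := Orb Λ)) :=
  (isNecessary_t2PrimeCondition (a + b)).isNecessaryInSector

/-- Sector instance: the **sector PQGT1 list** `IsDQGT1FeasibleSector a b` (DQG + `S_z` rows + `T1 ⪰ 0`,
`ErdahlT1Condition.lean`) is necessary in the sector `(a, b)` (`IsDQGT1FeasibleSector.of_state`) — the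
necessity declaration a `DQGT1` lower row cites together with `le_sectorGroundEnergy_of_forall_necessary`
(or directly `le_sectorGroundEnergy_of_forall_isDQGT1FeasibleSector`). [cite: NakataEtAl2008, §II.A-C] -/
theorem isNecessaryInSector_isDQGT1FeasibleSector (a b : ℕ) :
    IsNecessaryInSector a b (IsDQGT1FeasibleSector (Λ := Λ) a b) :=
  fun _ hψ h1 => IsDQGT1FeasibleSector.of_state hψ h1

/-- Sector instance: the **sector PQGT1T2 list** `IsDQGT1T2FeasibleSector a b` (`T2Condition.lean`) is
necessary in the sector `(a, b)` (`IsDQGT1T2FeasibleSector.of_state`) — the necessity declaration a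
`DQGT1T2` lower row cites. [cite: NakataEtAl2008, §II.A-C] -/
theorem isNecessaryInSector_isDQGT1T2FeasibleSector (a b : ℕ) :
    IsNecessaryInSector a b (IsDQGT1T2FeasibleSector (Λ := Λ) a b) :=
  fun _ hψ h1 => IsDQGT1T2FeasibleSector.of_state hψ h1

end Sector

/-! ### 2. Closure of necessity under list-building operations -/

section Closure

variable {ι : Type*} [LinearOrder ι] [Fintype ι] {Λ : Type*} [LinearOrder Λ] [Fintype Λ]

/-- **A family of necessary conditions is a necessary condition** (CSL's list `∀ ℓ = 1…L, 𝓛_ℓ(Γ) ≥ 0`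
of eq. (7), for an arbitrary index type — the conjunction `IsNecessary.and` iterated; "Additional
necessary conditions can be considered"). [cite: CancesStoltzLewin2006, §3 eq. (7)] -/
theorem isNecessary_forall {α : Type*} {N : ℕ}
    {C : α → Matrix ι ι ℂ → Matrix (ι × ι) (ι × ι) ℂ → Prop} (h : ∀ a, IsNecessary N (C a)) :
    IsNecessary N fun γ Γ => ∀ a, C a γ Γ :=
  fun ψ hN h1 a => h a ψ hN h1

/-- Sector form of `isNecessary_forall`: a family of sector-necessary conditions is sector-necessary.
[cite: CancesStoltzLewin2006, §3 eq. (7)] -/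
theorem isNecessaryInSector_forall {α : Type*} {a b : ℕ}
    {C : α → Matrix (Orb Λ) (Orb Λ) ℂ → Matrix (Orb Λ × Orb Λ) (Orb Λ × Orb Λ) ℂ → Prop}
    (h : ∀ x, IsNecessaryInSector a b (C x)) : IsNecessaryInSector a b fun γ Γ => ∀ x, C x γ Γ :=
  fun ψ hψ h1 x => h x ψ hψ h1

/-- **A finite family of positivity maps each of which is necessary is a necessary condition set**
(`PosMapFeasible L` of `DualConeLowerBound.lean`, CSL eq. (7): the approximate cone
`𝒞_app = {Γ | ∀ ℓ, 𝓛_ℓ(Γ) ≥ 0}` contains `𝒞_N` as soon as each `𝓛_ℓ(Γ) ≥ 0` does) — the hypothesis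
`IsNecessary N (PosMapFeasible L)` of `le_groundEnergy_of_dualCone_certificate` discharged block by block
from the instances of §1. [cite: CancesStoltzLewin2006, §3 eq. (7)] -/
theorem isNecessary_posMapFeasible {κ : Type*} [Fintype κ] {X : κ → Type*} [∀ c, Fintype (X c)]
    {N : ℕ} {L : ∀ c : κ, Matrix ι ι ℂ → Matrix (ι × ι) (ι × ι) ℂ → Matrix (X c) (X c) ℂ}
    (h : ∀ c, IsNecessary N fun γ Γ => (L c γ Γ).PosSemidef) : IsNecessary N (PosMapFeasible L) :=
  fun ψ hN h1 c => h c ψ hN h1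

/-- Sector form of `isNecessary_posMapFeasible` (the hypothesis `IsNecessaryInSector a b (PosMapFeasible L)`
of `le_sectorGroundEnergy_of_dualCone_certificate`, block by block). [cite: CancesStoltzLewin2006, §3 eq. (7)] -/
theorem isNecessaryInSector_posMapFeasible {κ : Type*} [Fintype κ] {X : κ → Type*}
    [∀ c, Fintype (X c)] {a b : ℕ}
    {L : ∀ c : κ, Matrix (Orb Λ) (Orb Λ) ℂ → Matrix (Orb Λ × Orb Λ) (Orb Λ × Orb Λ) ℂ →
      Matrix (X c) (X c) ℂ}
    (h : ∀ c, IsNecessaryInSector a b fun γ Γ => (L c γ Γ).PosSemidef) :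
    IsNecessaryInSector a b (PosMapFeasible L) :=
  fun ψ hψ h1 c => h c ψ hψ h1

/-- **RESTRICTION TO A PRINCIPAL SUBMATRIX KEEPS A POSITIVITY CONDITION NECESSARY.** If the matrix
condition `M(γ, Γ) ⪰ 0` is necessary for `N` electrons, then for every re-indexing map `e : κ → m`
(e.g. the inclusion of a chosen sub-family of rows — block-selected "restricted" three-index conditions,
`RestrictedThreeIndexConditions.lean`) the condition `M(γ, Γ)[e, e] ⪰ 0` on the re-indexed principal
submatrix is necessary: a principal submatrix of a positive semidefinite matrix is positive semidefinite
(Horn–Johnson Observation 7.1.2; `Matrix.PosSemidef.submatrix`). In dual terms: a multiplier supported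
on a principal sub-block is a valid multiplier for the full condition. [cite: HornJohnson2013, Obs. 7.1.2] -/
theorem IsNecessary.posSemidef_submatrix {m : Type*} [Fintype m] {N : ℕ}
    {M : Matrix ι ι ℂ → Matrix (ι × ι) (ι × ι) ℂ → Matrix m m ℂ}
    (h : IsNecessary N fun γ Γ => (M γ Γ).PosSemidef) {κ : Type*} [Fintype κ] (e : κ → m) :
    IsNecessary N fun γ Γ => ((M γ Γ).submatrix e e).PosSemidef :=
  h.mono fun _ _ hM => hM.submatrix e

/-- Sector form of `IsNecessary.posSemidef_submatrix`: restricting a sector-necessary positivity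
condition to a principal submatrix keeps it sector-necessary. [cite: HornJohnson2013, Obs. 7.1.2] -/
theorem IsNecessaryInSector.posSemidef_submatrix {m : Type*} [Fintype m] {a b : ℕ}
    {M : Matrix (Orb Λ) (Orb Λ) ℂ → Matrix (Orb Λ × Orb Λ) (Orb Λ × Orb Λ) ℂ → Matrix m m ℂ}
    (h : IsNecessaryInSector a b fun γ Γ => (M γ Γ).PosSemidef) {κ : Type*} [Fintype κ]
    (e : κ → m) : IsNecessaryInSector a b fun γ Γ => ((M γ Γ).submatrix e e).PosSemidef :=
  h.mono fun _ _ hM => hM.submatrix e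

/-- Instance: every **restricted T1 condition** `(t1Map γ Γ)[e, e] ⪰ 0`, `e : κ → ι × ι × ι` (e.g. the
triples with all indices in an orbital subset), is necessary for every `N` (Nakata et al. 2008 §II.A with
Horn–Johnson Obs. 7.1.2; state form `t1Transpose_submatrix_posSemidef`). [cite: NakataEtAl2008, §II.A-C] -/
theorem isNecessary_t1Map_submatrix (N : ℕ) {κ : Type*} [Fintype κ] (e : κ → ι × ι × ι) :
    IsNecessary N fun (γ : Matrix ι ι ℂ) (Γ : Matrix (ι × ι) (ι × ι) ℂ) =>
      ((t1Map γ Γ).submatrix e e).PosSemidef :=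
  (isNecessary_t1Condition N).posSemidef_submatrix e

/-- Instance: every **restricted T2 condition** `(t2Map γ Γ)[e, e] ⪰ 0`, `e : κ → ι × ι × ι`, is
necessary for every `N` (state form `t2Anticomm_submatrix_posSemidef`). [cite: NakataEtAl2008, §II.A-C] -/
theorem isNecessary_t2Map_submatrix (N : ℕ) {κ : Type*} [Fintype κ] (e : κ → ι × ι × ι) :
    IsNecessary N fun (γ : Matrix ι ι ℂ) (Γ : Matrix (ι × ι) (ι × ι) ℂ) =>
      ((t2Map γ Γ).submatrix e e).PosSemidef :=
  (isNecessary_t2Condition N).posSemidef_submatrix e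

/-- Instance: every **restricted T2′ condition** `(t2PrimeMap γ Γ)[e, e] ⪰ 0`, `e : κ → (ι × ι × ι) ⊕ ι`
(a sub-family of the `a†a†a` triples together with some of the singles `a†` — the low-rank / block-selected
`T2′` multipliers of restricted variational 2-RDM lower bounds), is necessary for every `N` (state form
`t2Prime_submatrix_posSemidef`); hence "any dual-feasible restriction is still a valid certificate" and
`E_DQG ≤ E_DQG+T2′[A] ≤ E_DQGT1T2′`. [cite: NakataEtAl2008, §II.A-C] -/
theorem isNecessary_t2PrimeMap_submatrix (N : ℕ) {κ : Type*} [Fintype κ] (e : κ → (ι × ι × ι) ⊕ ι) :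
    IsNecessary N fun (γ : Matrix ι ι ℂ) (Γ : Matrix (ι × ι) (ι × ι) ℂ) =>
      ((t2PrimeMap γ Γ).submatrix e e).PosSemidef :=
  (isNecessary_t2PrimeCondition N).posSemidef_submatrix e

/-- Sector instance: restricted `T1` conditions are necessary in every sector `(a, b)`.
[cite: NakataEtAl2008, §II.A-C] -/
theorem isNecessaryInSector_t1Map_submatrix (a b : ℕ) {κ : Type*} [Fintype κ]
    (e : κ → Orb Λ × Orb Λ × Orb Λ) :
    IsNecessaryInSector a b
      fun (γ : Matrix (Orb Λ) (Orb Λ) ℂ) (Γ : Matrix (Orb Λ × Orb Λ) (Orb Λ × Orb Λ) ℂ) =>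
        ((t1Map γ Γ).submatrix e e).PosSemidef :=
  (isNecessary_t1Map_submatrix (a + b) e).isNecessaryInSector

/-- Sector instance: restricted `T2` conditions are necessary in every sector `(a, b)`.
[cite: NakataEtAl2008, §II.A-C] -/
theorem isNecessaryInSector_t2Map_submatrix (a b : ℕ) {κ : Type*} [Fintype κ]
    (e : κ → Orb Λ × Orb Λ × Orb Λ) :
    IsNecessaryInSector a b
      fun (γ : Matrix (Orb Λ) (Orb Λ) ℂ) (Γ : Matrix (Orb Λ × Orb Λ) (Orb Λ × Orb Λ) ℂ) =>
        ((t2Map γ Γ).submatrix e e).PosSemidef :=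
  (isNecessary_t2Map_submatrix (a + b) e).isNecessaryInSector

/-- Sector instance: restricted `T2′` conditions are necessary in every sector `(a, b)` — the necessity
declaration a `DQG + restricted-T2′` lower row cites (conjoined with `isNecessaryInSector_isDQGFeasibleSector`
by `IsNecessaryInSector.and`). [cite: NakataEtAl2008, §II.A-C] -/
theorem isNecessaryInSector_t2PrimeMap_submatrix (a b : ℕ) {κ : Type*} [Fintype κ]
    (e : κ → (Orb Λ × Orb Λ × Orb Λ) ⊕ Orb Λ) :
    IsNecessaryInSector a b
      fun (γ : Matrix (Orb Λ) (Orb Λ) ℂ) (Γ : Matrix (Orb Λ × Orb Λ) (Orb Λ × Orb Λ) ℂ) =>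
        ((t2PrimeMap γ Γ).submatrix e e).PosSemidef :=
  (isNecessary_t2PrimeMap_submatrix (a + b) e).isNecessaryInSector

end Closure

end Literature.MathematicalPhysics.QuantumChemistry
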